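import Summits.AtomisticToContinuum.Crystallization.Theorems.FrustratedLawDichotomyStrainedPatchHostCellsA

/-!
# Graded tube: the AND-node of record with a RADIAL TOLERANCE PROFILE («GradedTube», lens-5 g77)

Lens-5 («finite / base range + asymptotic regime + bridge») node on the 27623 T-leaf, TARGET OF RECORD
`CoreOffTubeFloor (63/10) (63/10) (24/5) (1/100) 0` **[CORE-FAR]**, reached in the tree through the AND-node
`TubeFloor 𝓘 τ ∧ FamilyCover 𝓘 (24/5) (1/100) (1/8) τ` (`…HostCells.coreOff_of_tubeFloor_of_cover_eighth`) at ONE scalar tolerance `τ`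
(record `τ = 1/100`).

THE RE-CUT.  The two leaves pull the scalar `τ` in opposite directions and bind at DIFFERENT RADII: the certificate (`TubeFloor`, census SLACK-36 /
GradStep) is decided on the host shells `R₀ ∈ [1, 3]` (80 % of the dual mass of the LP of record) and its remainder price falls with the
tolerance of THOSE sites, while the cover (`FamilyCover`, census COVER-60) binds at the RIM `R₀ ∈ [5, 63/10]`, where the polynomial-chart residual
of every measured admissible cluster is largest (monotone shell profiles: degree-3 residual `≤ 1.6·10⁻³` on `R₀ ≤ 3`, `≤ 5.3·10⁻³` up to shell 5 on the
off-tube terminals, against a rim allowance that XRT-type competitors want at `2–3·10⁻²`).  A scalar `τ` couples the two.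
This file replaces the scalar by a TOLERANCE TABLE `T : (M₀ : ℕ) → (Fin M₀ → E3) → Fin M₀ → Fin M₀ → ℝ` (per host cell and host SITE, the shape of the
census's `SlackTab`), keeps the scalar `τ` as the rim/covering value, and proves the same junction for every table:

* §0 tables: `constTol τ`, `radialTol f` (a profile of the host radius), `gradeTol R_g τ_in τ_out` (two-level: `τ_in` on host radius `≤ R_g`,
  `τ_out` beyond), the order `TolLE`;
* §1 `ChartByG 𝓘 τ T` := `ChartBy 𝓘 τ τ` ∧ (site `a` of the `63/10`-ball deviates from its host site `e a` by `≤ T(e a)`); monotone in `T` and in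
  the family; `= ChartBy` at `T = constTol τ` (`chartByG_constTol_iff`); pair deviations `≤ T(e a) + T(e b)` (`chartByG_bond`) — the hook by which a
  graded box enters the certificate's difference tables (`2τ ↦ T h + T h′`);
* §2 the graded leaves `TubeFloorG 𝓘 τ T` [CERTIFICATE · ANTITONE in `T` · WEAKER than `TubeFloor 𝓘 τ` for EVERY `T` (`tubeFloorG_of_tubeFloor`)]
  and `FamilyCoverG 𝓘 ρ ε η₂ τ T` [GEOMETRIC · MONOTONE in `T` · STRONGER than `FamilyCover … τ` (`familyCover_of_familyCoverG`)], both `↔` the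
  scalar leaves at `T = constTol τ` (and at any `T ≥ τ`); ★★ `gradedTube_sandwich`: at the two-level profile the graded node sits BETWEEN the
  uniform nodes at `τ_in` and at `τ_out` (certificate: loose-uniform ⟹ graded ⟹ tight-uniform; cover: tight-uniform ⟹ graded ⟹ loose-uniform);
* §3 ★★ the junction `coreOff_of_tubeFloorG_of_coverG_eighth : TubeFloorG 𝓘 τ T → FamilyCoverG 𝓘 ρ ε (1/8) τ T → CoreOffTubeFloor (63/10) (63/10) ρ ε 0`
  for every family, scalar and table, its record instance `coreOff_record_of_gradedTube`, the two-level instance `coreOff_record_of_gradeTol`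
  (`T = gradeTol R_g τ_in (1/100)`, scalar `1/100`), and the recovery of the scalar node (`coreOff_record_of_constTol`).

THE DIAL (lens grammar).  Finite/base range = the interior host ball `R₀ ≤ R_g` at tight `τ_in` — where the certificate is decided; asymptotic regime =
the rim annulus `R_g < R₀ ≤ 63/10` at the scalar `τ` — where only the cover binds (certificate rows there are `X`-capped); bridge = this junction +
the trade lemma `gradedTube_trade` (tightening `T` weakens the certificate leaf and strengthens the cover leaf, nothing else moves).  «How far the finite
range must reach»: `R_g ≥ R_X + r` (binding rows' whole partner stars inside `R_g`); which `(R_g, τ_in)` closes is the census's (asks CERT-G / COVER-G of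
memo NODE-g77), Lean fixes no number.  Zero edits to landed declarations; no sorry, no new axioms, no instances / notation / options.
-/

namespace Summit.AtomisticToContinuum.Crystallization.Theorems.FrustratedLawDichotomyStrainedPatchGradedTube

open scoped BigOperators Classical
open Summit.AtomisticToContinuum.Crystallization.Theorems.FrustratedLawDichotomyMotifLemmas
open Summit.AtomisticToContinuum.Crystallization.Theorems.FrustratedLawDichotomyAveragingCut
open Summit.AtomisticToContinuum.Crystallization.Theorems.FrustratedLawDichotomyAveragingRuleCap
open Summit.AtomisticToContinuum.Crystallization.Theorems.FrustratedLawDichotomyAveragingRuleTightFree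
open Summit.AtomisticToContinuum.Crystallization.Theorems.FrustratedLawDichotomyExemptAbsorption
open Summit.AtomisticToContinuum.Crystallization.Theorems.FrustratedLawDichotomyExemptAbsorptionRecord
open Summit.AtomisticToContinuum.Crystallization.Theorems.FrustratedLawDichotomyStrainedPatchHomSplit
open Summit.AtomisticToContinuum.Crystallization.Theorems.FrustratedLawDichotomyStrainedPatchCleanCollar
open Summit.AtomisticToContinuum.Crystallization.Theorems.FrustratedLawDichotomyStrainedPatchHomTube
open Summit.AtomisticToContinuum.Crystallization.Theorems.FrustratedLawDichotomyStrainedPatchHomIsometry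
open Summit.AtomisticToContinuum.Crystallization.Theorems.FrustratedLawDichotomyStrainedPatchHomTubeIso
open Summit.AtomisticToContinuum.Crystallization.Theorems.FrustratedLawDichotomyStrainedPatchPhaseCut
open Summit.AtomisticToContinuum.Crystallization.Theorems.FrustratedLawDichotomyStrainedPatchCoreTube
open Summit.AtomisticToContinuum.Crystallization.Theorems.FrustratedLawDichotomyStrainedPatchCoreTubeRecord
open Summit.AtomisticToContinuum.Crystallization.Theorems.FrustratedLawDichotomyStrainedPatchStrainBands
open Summit.AtomisticToContinuum.Crystallization.Theorems.FrustratedLawDichotomyStrainedPatchChartFamilies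
open Summit.AtomisticToContinuum.Crystallization.Theorems.FrustratedLawDichotomyStrainedPatchHostCells

/-! ## §0. Tolerance tables -/

/-- The constant table `τ`. -/
def constTol (τ : ℝ) : (M₀ : ℕ) → (Fin M₀ → E3) → Fin M₀ → Fin M₀ → ℝ := fun _ _ _ _ => τ

/-- A RADIAL PROFILE: tolerance `f(R₀)` at a host site of host radius `R₀ = dist (z₀ b) (z₀ c₀)`. -/
noncomputable def radialTol (f : ℝ → ℝ) : (M₀ : ℕ) → (Fin M₀ → E3) → Fin M₀ → Fin M₀ → ℝ :=
  fun _ z₀ c₀ b => f (dist (z₀ b) (z₀ c₀))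

/-- The TWO-LEVEL profile: `τ_in` on host radius `≤ R_g` (the finite range), `τ_out` beyond (the rim regime). -/
noncomputable def gradeTol (Rg τin τout : ℝ) : (M₀ : ℕ) → (Fin M₀ → E3) → Fin M₀ → Fin M₀ → ℝ :=
  fun _ z₀ c₀ b => if dist (z₀ b) (z₀ c₀) ≤ Rg then τin else τout

/-- Pointwise order of tables. -/
def TolLE (T T' : (M₀ : ℕ) → (Fin M₀ → E3) → Fin M₀ → Fin M₀ → ℝ) : Prop :=
  ∀ (M₀ : ℕ) (z₀ : Fin M₀ → E3) (c₀ b : Fin M₀), T M₀ z₀ c₀ b ≤ T' M₀ z₀ c₀ b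
/-- `TolLE.refl` (docstring added by the landing lane; see the module docstring). [formal bookkeeping] -/
theorem TolLE.refl (T : (M₀ : ℕ) → (Fin M₀ → E3) → Fin M₀ → Fin M₀ → ℝ) : TolLE T T := fun _ _ _ _ => le_rfl
/-- `TolLE.trans` (docstring added by the landing lane; see the module docstring). [formal bookkeeping] -/
theorem TolLE.trans {T T' T'' : (M₀ : ℕ) → (Fin M₀ → E3) → Fin M₀ → Fin M₀ → ℝ} (h : TolLE T T') (h' : TolLE T' T'') : TolLE T T'' :=
  fun M₀ z₀ c₀ b => (h M₀ z₀ c₀ b).trans (h' M₀ z₀ c₀ b)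
/-- `constTol_apply` (docstring added by the landing lane; see the module docstring). [formal bookkeeping] -/
theorem constTol_apply (τ : ℝ) (M₀ : ℕ) (z₀ : Fin M₀ → E3) (c₀ b : Fin M₀) : constTol τ M₀ z₀ c₀ b = τ := rfl
/-- `radialTol_apply` (docstring added by the landing lane; see the module docstring). [formal bookkeeping] -/
theorem radialTol_apply (f : ℝ → ℝ) (M₀ : ℕ) (z₀ : Fin M₀ → E3) (c₀ b : Fin M₀) :
    radialTol f M₀ z₀ c₀ b = f (dist (z₀ b) (z₀ c₀)) := rfl

/-- The two-level profile is the radial profile of a step function. [formal bookkeeping] -/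
theorem gradeTol_eq_radialTol (Rg τin τout : ℝ) : gradeTol Rg τin τout = radialTol (fun s => if s ≤ Rg then τin else τout) := rfl
/-- `gradeTol_of_le` (docstring added by the landing lane; see the module docstring). [formal bookkeeping] -/
theorem gradeTol_of_le {Rg τin τout : ℝ} {M₀ : ℕ} {z₀ : Fin M₀ → E3} {c₀ b : Fin M₀} (h : dist (z₀ b) (z₀ c₀) ≤ Rg) :
    gradeTol Rg τin τout M₀ z₀ c₀ b = τin := by
  simp [gradeTol, h]
/-- `gradeTol_of_lt` (docstring added by the landing lane; see the module docstring). [formal bookkeeping] -/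
theorem gradeTol_of_lt {Rg τin τout : ℝ} {M₀ : ℕ} {z₀ : Fin M₀ → E3} {c₀ b : Fin M₀} (h : Rg < dist (z₀ b) (z₀ c₀)) :
    gradeTol Rg τin τout M₀ z₀ c₀ b = τout := by
  simp [gradeTol, not_le.2 h]
/-- `gradeTol_le_max` (docstring added by the landing lane; see the module docstring). [formal bookkeeping] -/
theorem gradeTol_le_max (Rg τin τout : ℝ) (M₀ : ℕ) (z₀ : Fin M₀ → E3) (c₀ b : Fin M₀) : gradeTol Rg τin τout M₀ z₀ c₀ b ≤ max τin τout := by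
  unfold gradeTol
  split_ifs
  · exact le_max_left _ _
  · exact le_max_right _ _
/-- `min_le_gradeTol` (docstring added by the landing lane; see the module docstring). [formal bookkeeping] -/
theorem min_le_gradeTol (Rg τin τout : ℝ) (M₀ : ℕ) (z₀ : Fin M₀ → E3) (c₀ b : Fin M₀) : min τin τout ≤ gradeTol Rg τin τout M₀ z₀ c₀ b := by
  unfold gradeTol
  split_ifs
  · exact min_le_left _ _
  · exact min_le_right _ _

/-- A constant profile with equal levels is the constant table. [formal bookkeeping] -/
theorem gradeTol_self (Rg τ : ℝ) : gradeTol Rg τ τ = constTol τ := by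
  funext M₀ z₀ c₀ b
  unfold gradeTol constTol
  split_ifs <;> rfl

/-- The two-level profile is monotone in both levels. [formal bookkeeping] -/
theorem tolLE_gradeTol_mono {Rg τin τin' τout τout' : ℝ} (hin : τin ≤ τin') (hout : τout ≤ τout') :
    TolLE (gradeTol Rg τin τout) (gradeTol Rg τin' τout') := by
  intro M₀ z₀ c₀ b
  unfold gradeTol
  split_ifs
  · exact hin
  · exact hout

/-- … and lies below the constant table of its larger level. [formal bookkeeping] -/
theorem tolLE_gradeTol_const {Rg τin τout τ : ℝ} (hin : τin ≤ τ) (hout : τout ≤ τ) : TolLE (gradeTol Rg τin τout) (constTol τ) :=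
  fun M₀ z₀ c₀ b => (gradeTol_le_max Rg τin τout M₀ z₀ c₀ b).trans (max_le hin hout)
/-- `tolLE_const_gradeTol` (docstring added by the landing lane; see the module docstring). [formal bookkeeping] -/
theorem tolLE_const_gradeTol {Rg τin τout τ : ℝ} (hin : τ ≤ τin) (hout : τ ≤ τout) : TolLE (constTol τ) (gradeTol Rg τin τout) :=
  fun M₀ z₀ c₀ b => (le_min hin hout).trans (min_le_gradeTol Rg τin τout M₀ z₀ c₀ b)
/-- `tolLE_constTol` (docstring added by the landing lane; see the module docstring). [formal bookkeeping] -/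
theorem tolLE_constTol {τ τ' : ℝ} (h : τ ≤ τ') : TolLE (constTol τ) (constTol τ') := fun _ _ _ _ => h

/-- A radial profile of a pointwise smaller function is a smaller table. [formal bookkeeping] -/
theorem tolLE_radialTol {f g : ℝ → ℝ} (h : ∀ s, f s ≤ g s) : TolLE (radialTol f) (radialTol g) := fun _ _ _ _ => h _

/-! ## §1. Graded charts -/

/-- **`ChartByG 𝓘 τ T z c z₀ c₀ e`** — a chart `ChartBy 𝓘 τ τ` (coarse = fine = the scalar `τ`, covering radius `63/10 − τ`, injective on the ball) whose
sites of the `63/10`-ball ADDITIONALLY deviate from their host sites by at most the table's value AT THE HOST SITE: `‖(z a − z c) − (z₀ (e a) − z₀ c₀)‖ ≤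
T(z₀)(e a)`. -/
def ChartByG (𝓘 : (M₀ : ℕ) → (Fin M₀ → E3) → Fin M₀ → Prop) (τ : ℝ) (T : (M₀ : ℕ) → (Fin M₀ → E3) → Fin M₀ → Fin M₀ → ℝ) {M : ℕ}
    (z : Fin M → E3) (c : Fin M) {M₀ : ℕ} (z₀ : Fin M₀ → E3) (c₀ : Fin M₀) (e : Fin M → Fin M₀) : Prop :=
  ChartBy 𝓘 τ τ z c z₀ c₀ e ∧ ∀ a, dist (z a) (z c) ≤ 63 / 10 → dist (z a - z c) (z₀ (e a) - z₀ c₀) ≤ T M₀ z₀ c₀ (e a)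

section Chart

variable {𝓘 𝓘' : (M₀ : ℕ) → (Fin M₀ → E3) → Fin M₀ → Prop} {τ t : ℝ} {T T' : (M₀ : ℕ) → (Fin M₀ → E3) → Fin M₀ → Fin M₀ → ℝ} {M : ℕ}
  {z : Fin M → E3} {c : Fin M} {M₀ : ℕ} {z₀ : Fin M₀ → E3} {c₀ : Fin M₀} {e : Fin M → Fin M₀}

/-- A graded chart is a scalar chart. [formal bookkeeping] -/
theorem ChartByG.chartBy (h : ChartByG 𝓘 τ T z c z₀ c₀ e) : ChartBy 𝓘 τ τ z c z₀ c₀ e := h.1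

/-- The graded deviation clause. [formal bookkeeping] -/
theorem ChartByG.dev (h : ChartByG 𝓘 τ T z c z₀ c₀ e) {a : Fin M} (ha : dist (z a) (z c) ≤ 63 / 10) :
    dist (z a - z c) (z₀ (e a) - z₀ c₀) ≤ T M₀ z₀ c₀ (e a) := h.2 a ha

/-- The graded deviation clause in displacement form `‖D a‖ ≤ T(e a)`, `D a := (z a − z c) − (z₀ (e a) − z₀ c₀)`. [formal bookkeeping] -/
theorem ChartByG.norm_disp (h : ChartByG 𝓘 τ T z c z₀ c₀ e) {a : Fin M} (ha : dist (z a) (z c) ≤ 63 / 10) :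
    ‖(z a - z c) - (z₀ (e a) - z₀ c₀)‖ ≤ T M₀ z₀ c₀ (e a) := by
  rw [← dist_eq_norm]; exact h.2 a ha

/-- ★ A scalar chart (any fine deviation) under a table that is nowhere below the scalar is a graded chart: the profile clause is then implied by the coarse
clause.  [formal bookkeeping] -/
theorem chartByG_of_chartBy (h : ChartBy 𝓘 τ t z c z₀ c₀ e) (hT : ∀ b : Fin M₀, τ ≤ T M₀ z₀ c₀ b) : ChartByG 𝓘 τ T z c z₀ c₀ e :=
  ⟨chartBy_fine_self h, fun a ha => (h.2.2.1 a ha).trans (hT (e a))⟩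

/-- ★ At the constant table the graded chart IS the scalar chart of record. [formal bookkeeping] -/
theorem chartByG_constTol_iff : ChartByG 𝓘 τ (constTol τ) z c z₀ c₀ e ↔ ChartBy 𝓘 τ τ z c z₀ c₀ e :=
  ⟨fun h => h.1, fun h => chartByG_of_chartBy h fun _ => le_rfl⟩

/-- The scalar chart loosens with the coarse parameter (deviation clauses and the covering radius `63/10 − τ`). [formal bookkeeping] -/
theorem chartBy_mono_coarse {τ' : ℝ} (h : ChartBy 𝓘 τ' t z c z₀ c₀ e) (hle : τ' ≤ τ) : ChartBy 𝓘 τ t z c z₀ c₀ e :=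
  ⟨h.1, h.2.1, fun a ha => (h.2.2.1 a ha).trans hle, h.2.2.2.1, h.2.2.2.2.1, fun b₀ hb₀ => h.2.2.2.2.2 b₀ (by linarith)⟩

/-- ★ A TIGHT scalar chart (coarse `τ' ≤ τ`) under a table nowhere below `τ'` is a graded chart at scalar `τ`: uniform tightness is the strongest grading.
[formal bookkeeping] -/
theorem chartByG_of_chartBy_tight {τ' : ℝ} (h : ChartBy 𝓘 τ' t z c z₀ c₀ e) (hle : τ' ≤ τ) (hT : ∀ b : Fin M₀, τ' ≤ T M₀ z₀ c₀ b) :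
    ChartByG 𝓘 τ T z c z₀ c₀ e :=
  ⟨chartBy_fine_self (chartBy_mono_coarse h hle), fun a ha => (h.2.2.1 a ha).trans (hT (e a))⟩

/-- … in particular a uniform `τ_in`-chart is a two-level `(τ_in | τ_out)`-graded chart at scalar `τ_out ≥ τ_in`. [formal bookkeeping] -/
theorem chartByG_gradeTol_of_chartBy {Rg τin τout : ℝ} (h : ChartBy 𝓘 τin τin z c z₀ c₀ e) (hle : τin ≤ τout) :
    ChartByG 𝓘 τout (gradeTol Rg τin τout) z c z₀ c₀ e :=
  chartByG_of_chartBy_tight h hle fun b => (le_min le_rfl hle).trans (min_le_gradeTol Rg τin τout M₀ z₀ c₀ b)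

/-- The graded chart loosens with the table. [formal bookkeeping] -/
theorem ChartByG.mono_tol (h : ChartByG 𝓘 τ T z c z₀ c₀ e) (hle : TolLE T T') : ChartByG 𝓘 τ T' z c z₀ c₀ e :=
  ⟨h.1, fun a ha => (h.2 a ha).trans (hle M₀ z₀ c₀ (e a))⟩

/-- … and with the family. [formal bookkeeping] -/
theorem ChartByG.mono_family (h : ChartByG 𝓘 τ T z c z₀ c₀ e) (hle : FamilyLE 𝓘 𝓘') : ChartByG 𝓘' τ T z c z₀ c₀ e :=
  ⟨h.1.mono_family hle, h.2⟩

/-- Two profiles on the same chart meet. [formal bookkeeping] -/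
theorem ChartByG.inf (h : ChartByG 𝓘 τ T z c z₀ c₀ e) (h' : ChartByG 𝓘 τ T' z c z₀ c₀ e) :
    ChartByG 𝓘 τ (fun M₀ z₀ c₀ b => min (T M₀ z₀ c₀ b) (T' M₀ z₀ c₀ b)) z c z₀ c₀ e :=
  ⟨h.1, fun a ha => le_min (h.2 a ha) (h'.2 a ha)⟩

/-- The two-tolerance triangle inequality: sites charted within `τa`, `τb` have pair distances within `τa + τb`. [folklore] -/
theorem bond_dev_le₂ {u v w u₀ v₀ w₀ : E3} {τa τb : ℝ} (ha : dist (u - w) (u₀ - w₀) ≤ τa) (hb : dist (v - w) (v₀ - w₀) ≤ τb) :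
    |dist u v - dist u₀ v₀| ≤ τa + τb := by
  rw [dist_eq_norm] at ha hb
  rw [dist_eq_norm, dist_eq_norm]
  have key : u - v - (u₀ - v₀) = (u - w - (u₀ - w₀)) - (v - w - (v₀ - w₀)) := by abel
  calc |‖u - v‖ - ‖u₀ - v₀‖| ≤ ‖u - v - (u₀ - v₀)‖ := abs_norm_sub_norm_le _ _
    _ = ‖(u - w - (u₀ - w₀)) - (v - w - (v₀ - w₀))‖ := by rw [key]
    _ ≤ ‖u - w - (u₀ - w₀)‖ + ‖v - w - (v₀ - w₀)‖ := norm_sub_le _ _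
    _ ≤ τa + τb := add_le_add ha hb

/-- The displacement-difference form: `‖D a − D b‖ ≤ T(e a) + T(e b)` — the graded BOX DIFFERENCE TABLE (`2τ ↦ T h + T h′`). [folklore] -/
theorem ChartByG.disp_diff (h : ChartByG 𝓘 τ T z c z₀ c₀ e) {a b : Fin M} (ha : dist (z a) (z c) ≤ 63 / 10) (hb : dist (z b) (z c) ≤ 63 / 10) :
    ‖((z a - z c) - (z₀ (e a) - z₀ c₀)) - ((z b - z c) - (z₀ (e b) - z₀ c₀))‖ ≤ T M₀ z₀ c₀ (e a) + T M₀ z₀ c₀ (e b) :=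
  (norm_sub_le _ _).trans (add_le_add (h.norm_disp ha) (h.norm_disp hb))

/-- ★ Pair deviation `≤ T(e a) + T(e b)` on the charted ball. [folklore] -/
theorem chartByG_bond (h : ChartByG 𝓘 τ T z c z₀ c₀ e) {a b : Fin M} (ha : dist (z a) (z c) ≤ 63 / 10) (hb : dist (z b) (z c) ≤ 63 / 10) :
    |dist (z a) (z b) - dist (z₀ (e a)) (z₀ (e b))| ≤ T M₀ z₀ c₀ (e a) + T M₀ z₀ c₀ (e b) :=
  bond_dev_le₂ (h.2 a ha) (h.2 b hb)

/-- … at the two-level profile, for two sites charted INTO the finite range: `≤ 2τ_in`. [formal bookkeeping] -/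
theorem chartByG_bond_interior {Rg τin τout : ℝ} (h : ChartByG 𝓘 τ (gradeTol Rg τin τout) z c z₀ c₀ e) {a b : Fin M}
    (ha : dist (z a) (z c) ≤ 63 / 10) (hb : dist (z b) (z c) ≤ 63 / 10) (ha₀ : dist (z₀ (e a)) (z₀ c₀) ≤ Rg) (hb₀ : dist (z₀ (e b)) (z₀ c₀) ≤ Rg) :
    |dist (z a) (z b) - dist (z₀ (e a)) (z₀ (e b))| ≤ 2 * τin := by
  have h₁ := chartByG_bond h ha hb
  rw [gradeTol_of_le ha₀, gradeTol_of_le hb₀] at h₁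
  linarith

/-- … one site in the finite range, one in the rim regime: `≤ τ_in + τ_out`. [formal bookkeeping] -/
theorem chartByG_bond_mixed {Rg τin τout : ℝ} (h : ChartByG 𝓘 τ (gradeTol Rg τin τout) z c z₀ c₀ e) {a b : Fin M}
    (ha : dist (z a) (z c) ≤ 63 / 10) (hb : dist (z b) (z c) ≤ 63 / 10) (ha₀ : dist (z₀ (e a)) (z₀ c₀) ≤ Rg) (hb₀ : Rg < dist (z₀ (e b)) (z₀ c₀)) :
    |dist (z a) (z b) - dist (z₀ (e a)) (z₀ (e b))| ≤ τin + τout := by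
  have h₁ := chartByG_bond h ha hb
  rwa [gradeTol_of_le ha₀, gradeTol_of_lt hb₀] at h₁

end Chart

/-! ## §2. The graded leaves -/

/-- **(TF-G) `TubeFloorG 𝓘 τ T` [CERTIFICATE]** — every admissible, `63/10`-clean, `63/10`-mono-phase record cluster that is GRADED-charted (scalar `τ`,
table `T`) by an instance of `𝓘` scores `≥ 0`.  Weaker than `TubeFloor 𝓘 τ` for every `T`; antitone in `T`. -/
def TubeFloorG (𝓘 : (M₀ : ℕ) → (Fin M₀ → E3) → Fin M₀ → Prop) (τ : ℝ) (T : (M₀ : ℕ) → (Fin M₀ → E3) → Fin M₀ → Fin M₀ → ℝ) : Prop :=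
  ∀ (M : ℕ) (z : Fin M → E3) (c : Fin M) (M₀ : ℕ) (z₀ : Fin M₀ → E3) (c₀ : Fin M₀) (e : Fin M → Fin M₀),
    Admissible M z c → CleanBall (63 / 10) z c → MonoPhaseBall (63 / 10) z c → ChartByG 𝓘 τ T z c z₀ c₀ e →
      0 ≤ ballAvg (9 / 5) z (xRec M z) c

/-- **(BC-G) `FamilyCoverG 𝓘 ρ ε η₂ τ T` [GEOMETRIC — the GRADED COVER]** — every far-class record cluster with an `η₂`-good centre is, modulo a linear
isometry, GRADED-charted (scalar `τ`, table `T`) by an instance of the family.  Stronger than `FamilyCover 𝓘 ρ ε η₂ τ`; monotone in `T`. -/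
def FamilyCoverG (𝓘 : (M₀ : ℕ) → (Fin M₀ → E3) → Fin M₀ → Prop) (ρ ε η₂ τ : ℝ) (T : (M₀ : ℕ) → (Fin M₀ → E3) → Fin M₀ → Fin M₀ → ℝ) : Prop :=
  ∀ (M : ℕ) (z : Fin M → E3) (c : Fin M), Admissible M z c → CleanBall (63 / 10) z c → MonoPhaseBall (63 / 10) z c → ¬NearHomIsoAt ρ ε z c →
    GoodAtScale η₂ (3 / 2) z c →
      ∃ (R : E3 ≃ₗᵢ[ℝ] E3) (M₀ : ℕ) (z₀ : Fin M₀ → E3) (c₀ : Fin M₀) (e : Fin M → Fin M₀), ChartByG 𝓘 τ T (⇑R ∘ z) c z₀ c₀ e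

section Leaves

variable {𝓘 𝓘' : (M₀ : ℕ) → (Fin M₀ → E3) → Fin M₀ → Prop} {ρ ε η₂ τ : ℝ} {T T' : (M₀ : ℕ) → (Fin M₀ → E3) → Fin M₀ → Fin M₀ → ℝ}

/-- ★ The graded tube floor is ANTITONE in the table: certified at a looser profile, it holds at every tighter one. [formal bookkeeping] -/
theorem TubeFloorG.anti_tol (h : TubeFloorG 𝓘 τ T') (hle : TolLE T T') : TubeFloorG 𝓘 τ T :=
  fun M z c M₀ z₀ c₀ e hz hcl hm hch => h M z c M₀ z₀ c₀ e hz hcl hm (hch.mono_tol hle)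

/-- … and ANTITONE in the family. [formal bookkeeping] -/
theorem TubeFloorG.anti_family (h : TubeFloorG 𝓘' τ T) (hle : FamilyLE 𝓘 𝓘') : TubeFloorG 𝓘 τ T :=
  fun M z c M₀ z₀ c₀ e hz hcl hm hch => h M z c M₀ z₀ c₀ e hz hcl hm (hch.mono_family hle)

/-- ★ The scalar tube floor gives the graded one at EVERY table (a graded chart is a scalar chart): (TF-G) is WEAKER than (TF). [formal bookkeeping] -/
theorem tubeFloorG_of_tubeFloor (h : TubeFloor 𝓘 τ) (T : (M₀ : ℕ) → (Fin M₀ → E3) → Fin M₀ → Fin M₀ → ℝ) : TubeFloorG 𝓘 τ T :=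
  fun M z c M₀ z₀ c₀ e hz hcl hm hch => h M z c M₀ z₀ c₀ e hz hcl hm hch.1

/-- … and conversely at any table nowhere below the scalar. [formal bookkeeping] -/
theorem tubeFloor_of_tubeFloorG (h : TubeFloorG 𝓘 τ T) (hT : TolLE (constTol τ) T) : TubeFloor 𝓘 τ :=
  fun M z c M₀ z₀ c₀ e hz hcl hm hch => h M z c M₀ z₀ c₀ e hz hcl hm (chartByG_of_chartBy hch fun b => hT M₀ z₀ c₀ b)

/-- ★ At the constant table the graded tube floor IS the tube floor of record. [formal bookkeeping] -/
theorem tubeFloorG_constTol_iff : TubeFloorG 𝓘 τ (constTol τ) ↔ TubeFloor 𝓘 τ :=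
  ⟨fun h => tubeFloor_of_tubeFloorG h (TolLE.refl _), fun h => tubeFloorG_of_tubeFloor h _⟩

/-- ★ The graded cover is MONOTONE in the table. [formal bookkeeping] -/
theorem FamilyCoverG.mono_tol (h : FamilyCoverG 𝓘 ρ ε η₂ τ T) (hle : TolLE T T') : FamilyCoverG 𝓘 ρ ε η₂ τ T' := by
  intro M z c hz hcl hm hn hg
  obtain ⟨R, M₀, z₀, c₀, e, hch⟩ := h M z c hz hcl hm hn hg
  exact ⟨R, M₀, z₀, c₀, e, hch.mono_tol hle⟩

/-- … and MONOTONE in the family. [formal bookkeeping] -/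
theorem FamilyCoverG.mono_family (h : FamilyCoverG 𝓘 ρ ε η₂ τ T) (hle : FamilyLE 𝓘 𝓘') : FamilyCoverG 𝓘' ρ ε η₂ τ T := by
  intro M z c hz hcl hm hn hg
  obtain ⟨R, M₀, z₀, c₀, e, hch⟩ := h M z c hz hcl hm hn hg
  exact ⟨R, M₀, z₀, c₀, e, hch.mono_family hle⟩

/-- … and MONOTONE in the window level `η₂` is inherited through `GoodAtScale` only contravariantly — not needed here; the graded cover gives the scalar
cover (BC) at the same `τ`: (BC-G) is STRONGER than (BC). [formal bookkeeping] -/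
theorem familyCover_of_familyCoverG (h : FamilyCoverG 𝓘 ρ ε η₂ τ T) : FamilyCover 𝓘 ρ ε η₂ τ := by
  intro M z c hz hcl hm hn hg
  obtain ⟨R, M₀, z₀, c₀, e, hch⟩ := h M z c hz hcl hm hn hg
  exact ⟨R, M₀, z₀, c₀, e, hch.1⟩

/-- … and conversely at any table nowhere below the scalar. [formal bookkeeping] -/
theorem familyCoverG_of_familyCover (h : FamilyCover 𝓘 ρ ε η₂ τ) (hT : TolLE (constTol τ) T) : FamilyCoverG 𝓘 ρ ε η₂ τ T := by
  intro M z c hz hcl hm hn hg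
  obtain ⟨R, M₀, z₀, c₀, e, hch⟩ := h M z c hz hcl hm hn hg
  exact ⟨R, M₀, z₀, c₀, e, chartByG_of_chartBy hch fun b => hT M₀ z₀ c₀ b⟩

/-- ★ At the constant table the graded cover IS the cover of record. [formal bookkeeping] -/
theorem familyCoverG_constTol_iff : FamilyCoverG 𝓘 ρ ε η₂ τ (constTol τ) ↔ FamilyCover 𝓘 ρ ε η₂ τ :=
  ⟨familyCover_of_familyCoverG, fun h => familyCoverG_of_familyCover h (TolLE.refl _)⟩

/-- ★ The graded tube floor at scalar `τ` and a table nowhere below `τ' ≤ τ` GIVES the uniform tube floor at the tight `τ'`: the graded certificate leaf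
is STRONGER than the uniformly-tight one (it must also carry the loose rim). [formal bookkeeping] -/
theorem tubeFloor_tight_of_tubeFloorG {τ' : ℝ} (h : TubeFloorG 𝓘 τ T) (hle : τ' ≤ τ) (hT : TolLE (constTol τ') T) : TubeFloor 𝓘 τ' :=
  fun M z c M₀ z₀ c₀ e hz hcl hm hch => h M z c M₀ z₀ c₀ e hz hcl hm (chartByG_of_chartBy_tight hch hle fun b => hT M₀ z₀ c₀ b)

/-- ★ … and the uniform cover at the tight `τ' ≤ τ` GIVES the graded cover at scalar `τ` and any table nowhere below `τ'`: the graded cover leaf is WEAKER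
than the uniformly-tight one. [formal bookkeeping] -/
theorem familyCoverG_of_familyCover_tight {τ' : ℝ} (h : FamilyCover 𝓘 ρ ε η₂ τ') (hle : τ' ≤ τ) (hT : TolLE (constTol τ') T) :
    FamilyCoverG 𝓘 ρ ε η₂ τ T := by
  intro M z c hz hcl hm hn hg
  obtain ⟨R, M₀, z₀, c₀, e, hch⟩ := h M z c hz hcl hm hn hg
  exact ⟨R, M₀, z₀, c₀, e, chartByG_of_chartBy_tight hch hle fun b => hT M₀ z₀ c₀ b⟩

/-- ★★ THE SANDWICH (two-level profile `τ_in ≤ τ_out`, scalar `τ_out`): the graded AND-node sits BETWEEN the two uniform AND-nodes — its certificate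
leaf is implied by the uniform-LOOSE certificate and implies the uniform-TIGHT one; its cover leaf is implied by the uniform-TIGHT cover and implies
the uniform-LOOSE one.  So it closes whenever either uniform node closes, and it CAN close when the loose certificate and the tight cover both fail.
[formal bookkeeping] -/
theorem gradedTube_sandwich (ρ ε η₂ : ℝ) {Rg τin τout : ℝ} (hle : τin ≤ τout) :
    (TubeFloor 𝓘 τout → TubeFloorG 𝓘 τout (gradeTol Rg τin τout)) ∧
      (TubeFloorG 𝓘 τout (gradeTol Rg τin τout) → TubeFloor 𝓘 τin) ∧
        (FamilyCover 𝓘 ρ ε η₂ τin → FamilyCoverG 𝓘 ρ ε η₂ τout (gradeTol Rg τin τout)) ∧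
          (FamilyCoverG 𝓘 ρ ε η₂ τout (gradeTol Rg τin τout) → FamilyCover 𝓘 ρ ε η₂ τout) :=
  ⟨fun h => tubeFloorG_of_tubeFloor h _, fun h => tubeFloor_tight_of_tubeFloorG h hle (tolLE_const_gradeTol le_rfl hle),
    fun h => familyCoverG_of_familyCover_tight h hle (tolLE_const_gradeTol le_rfl hle), familyCover_of_familyCoverG⟩

/-- ★ THE TRADE (the dial of the lens): tightening the table `T ≤ T'` WEAKENS the certificate leaf and STRENGTHENS the cover leaf; nothing else in the
AND-node moves. [formal bookkeeping] -/
theorem gradedTube_trade (hle : TolLE T T') :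
    (TubeFloorG 𝓘 τ T' → TubeFloorG 𝓘 τ T) ∧ (FamilyCoverG 𝓘 ρ ε η₂ τ T → FamilyCoverG 𝓘 ρ ε η₂ τ T') :=
  ⟨fun h => h.anti_tol hle, fun h => h.mono_tol hle⟩

end Leaves

/-! ## §3. The junction and the record -/

section Junction

variable {𝓘 : (M₀ : ℕ) → (Fin M₀ → E3) → Fin M₀ → Prop} {ρ ε η₂ τ : ℝ} {T : (M₀ : ℕ) → (Fin M₀ → E3) → Fin M₀ → Fin M₀ → ℝ}

/-- ★★ THE GRADED JUNCTION: (TF-G) ∧ (BC-G) ⟹ `EdgeFarFloor (63/10) (63/10) ρ ε η₂ 0` — chart the rotated cluster by the graded cover, apply the graded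
tube floor, the score is isometry-invariant.  Every family, scalar and table. [folklore] -/
theorem edgeFar_of_tubeFloorG_of_coverG (hT : TubeFloorG 𝓘 τ T) (hC : FamilyCoverG 𝓘 ρ ε η₂ τ T) :
    EdgeFarFloor (63 / 10) (63 / 10) ρ ε η₂ 0 := by
  intro M z c hz hcl hm hn hg
  obtain ⟨R, M₀, z₀, c₀, e, hch⟩ := hC M z c hz hcl hm hn hg
  have h₁ := hT M (⇑R ∘ z) c M₀ z₀ c₀ e ((admissible_comp_iff R z c).2 hz) ((cleanBall_comp_iff R z c).2 hcl)
    ((monoPhaseBall_comp_iff R z c).2 hm) hch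
  rwa [ballAvg_xRec_comp] at h₁

/-- ★★ … and at `η₂ = 1/8` the soft band is vacuous: (TF-G) ∧ (BC-G) ⟹ `CoreOffTubeFloor (63/10) (63/10) ρ ε 0`. [folklore] -/
theorem coreOff_of_tubeFloorG_of_coverG_eighth (hT : TubeFloorG 𝓘 τ T) (hC : FamilyCoverG 𝓘 ρ ε (1 / 8) τ T) :
    CoreOffTubeFloor (63 / 10) (63 / 10) ρ ε 0 :=
  (coreOff_iff_edge_and_soft _ _ ρ ε (1 / 8) 0).2 ⟨edgeFar_of_tubeFloorG_of_coverG hT hC, softFarFloor_eighth (by norm_num) _ _ _ _⟩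

/-- ★★ THE RECORD: the graded AND-node at ANY scalar `τ` and ANY table `T` gives the T-leaf target of record **[CORE-FAR]**
`CoreOffTubeFloor (63/10) (63/10) (24/5) (1/100) 0`. [formal bookkeeping] -/
theorem coreOff_record_of_gradedTube (hT : TubeFloorG 𝓘 τ T) (hC : FamilyCoverG 𝓘 (24 / 5) (1 / 100) (1 / 8) τ T) :
    CoreOffTubeFloor (63 / 10) (63 / 10) (24 / 5) (1 / 100) 0 :=
  coreOff_of_tubeFloorG_of_coverG_eighth hT hC

/-- ★ THE TWO-LEVEL INSTANCE at the scalar of record `1/100`: finite range `R₀ ≤ R_g` at `τ_in`, rim at `1/100`. [formal bookkeeping] -/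
theorem coreOff_record_of_gradeTol (Rg τin : ℝ) (hT : TubeFloorG 𝓘 (1 / 100) (gradeTol Rg τin (1 / 100)))
    (hC : FamilyCoverG 𝓘 (24 / 5) (1 / 100) (1 / 8) (1 / 100) (gradeTol Rg τin (1 / 100))) :
    CoreOffTubeFloor (63 / 10) (63 / 10) (24 / 5) (1 / 100) 0 :=
  coreOff_record_of_gradedTube hT hC

/-- ★ RECOVERY: at the constant table the graded node IS the scalar node of record (`…HostCells.coreOff_of_tubeFloor_of_cover_eighth`), leaf by leaf.
[formal bookkeeping] -/
theorem coreOff_record_of_constTol (hT : TubeFloor 𝓘 τ) (hC : FamilyCover 𝓘 (24 / 5) (1 / 100) (1 / 8) τ) :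
    CoreOffTubeFloor (63 / 10) (63 / 10) (24 / 5) (1 / 100) 0 :=
  coreOff_record_of_gradedTube (tubeFloorG_constTol_iff.2 hT) (familyCoverG_constTol_iff.2 hC)

/-- ★ THE RIM-LOOSENING direction (g76 §5, X76-K repair): a scalar tube floor at the LOOSE value `τ_out` already certifies every graded profile below it, so
a graded cover with interior `τ_in ≤ τ_out` and rim `τ_out` closes the node from `TubeFloor 𝓘 τ_out` — the certificate pays the loose box everywhere.
(The converse economy — paying `τ_in` on the finite range — is what (TF-G) itself expresses.) [formal bookkeeping] -/
theorem coreOff_record_of_tubeFloor_of_coverG (hT : TubeFloor 𝓘 τ) (hC : FamilyCoverG 𝓘 (24 / 5) (1 / 100) (1 / 8) τ T) :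
    CoreOffTubeFloor (63 / 10) (63 / 10) (24 / 5) (1 / 100) 0 :=
  coreOff_record_of_gradedTube (tubeFloorG_of_tubeFloor hT T) hC

/-- ★ THE INTERIOR-TIGHTENING direction (this node's economy): a graded certificate (tight `τ_in` on the finite range, scalar `τ_out` on the rim) and the
UNIFORM cover at `τ_in` close the node — the cover may over-deliver. [formal bookkeeping] -/
theorem coreOff_record_of_tubeFloorG_of_cover_tight {Rg τin τout : ℝ} (hle : τin ≤ τout) (hT : TubeFloorG 𝓘 τout (gradeTol Rg τin τout))
    (hC : FamilyCover 𝓘 (24 / 5) (1 / 100) (1 / 8) τin) : CoreOffTubeFloor (63 / 10) (63 / 10) (24 / 5) (1 / 100) 0 :=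
  coreOff_record_of_gradedTube hT ((gradedTube_sandwich _ _ _ hle).2.2.1 hC)

/-- ★ MIXED MONOTONICITY of the node: a certificate at a table `T'` and a cover at a table `T ≤ T'` close it. [formal bookkeeping] -/
theorem coreOff_record_of_gradedTube_of_tolLE {T' : (M₀ : ℕ) → (Fin M₀ → E3) → Fin M₀ → Fin M₀ → ℝ} (hle : TolLE T T')
    (hT : TubeFloorG 𝓘 τ T') (hC : FamilyCoverG 𝓘 (24 / 5) (1 / 100) (1 / 8) τ T) : CoreOffTubeFloor (63 / 10) (63 / 10) (24 / 5) (1 / 100) 0 :=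
  coreOff_record_of_gradedTube (hT.anti_tol hle) hC

end Junction

end Summit.AtomisticToContinuum.Crystallization.Theorems.FrustratedLawDichotomyStrainedPatchGradedTube
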